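import Literature.MathematicalPhysics.StatisticalMechanics.HcpFccLatticeSums

/-!
# Certified hcp/fcc lattice sums: kernel-evaluated box floor sums (KernelA4)

Each theorem records the exact value of an integer box floor sum
`boxFloorSum 2 3 δ k R n 10^e = ∑_{|i|,|j| ≤ R} ⌊10^e / latticeNum 2 3 δ k i jⁿ⌋` (`c² = 2/3`; pattern
`δ`, layer `k`; `R = 40`, `n = 3`, `e = 18` resp. `R = 20`, `n = 6`, `e = 30`), evaluated by the
kernel (`decide +kernel`: structural recursion over the `(2R+1)²` shifted indices, GMP integer
arithmetic; no `native_decide`, standard axioms only).  The values were generated by `py/gen.py`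
from `py/boxsums_final.json` (item evidence) and are re-verified here by the kernel.  [folklore]
-/

namespace Literature.MathematicalPhysics.StatisticalMechanics.StackingSums

open Finset

/-- `boxFloorSum 2 3 0 38 40 3 10^18` (pattern `0`, layer `38`, exponent `3`). [folklore] -/
theorem boxFloorSum_3_0_38 : boxFloorSum 2 3 0 38 40 3 (10 ^ 18) = 2302581246 := by
  decide +kernel

/-- `boxFloorSum 2 3 1 38 40 3 10^18` (pattern `1`, layer `38`, exponent `3`). [folklore] -/
theorem boxFloorSum_3_1_38 : boxFloorSum 2 3 1 38 40 3 (10 ^ 18) = 2302463737 := by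
  decide +kernel

/-- `boxFloorSum 2 3 0 39 40 3 10^18` (pattern `0`, layer `39`, exponent `3`). [folklore] -/
theorem boxFloorSum_3_0_39 : boxFloorSum 2 3 0 39 40 3 (10 ^ 18) = 2053269197 := by
  decide +kernel

/-- `boxFloorSum 2 3 1 39 40 3 10^18` (pattern `1`, layer `39`, exponent `3`). [folklore] -/
theorem boxFloorSum_3_1_39 : boxFloorSum 2 3 1 39 40 3 (10 ^ 18) = 2053160721 := by
  decide +kernel

/-- `boxFloorSum 2 3 0 40 40 3 10^18` (pattern `0`, layer `40`, exponent `3`). [folklore] -/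
theorem boxFloorSum_3_0_40 : boxFloorSum 2 3 0 40 40 3 (10 ^ 18) = 1835261988 := by
  decide +kernel

/-- `boxFloorSum 2 3 1 40 40 3 10^18` (pattern `1`, layer `40`, exponent `3`). [folklore] -/
theorem boxFloorSum_3_1_40 : boxFloorSum 2 3 1 40 40 3 (10 ^ 18) = 1835161868 := by
  decide +kernel

/-- `boxFloorSum 2 3 0 0 40 3 10^18` (pattern `0`, layer `0`, exponent `3`). [folklore] -/
theorem boxFloorSum_3_0_0 : boxFloorSum 2 3 0 0 40 3 (10 ^ 18) = 8746064161077802 := by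
  decide +kernel

/-- `boxFloorSum 2 3 1 1 40 3 10^18` (pattern `1`, layer `1`, exponent `3`). [folklore] -/
theorem boxFloorSum_3_1_1 : boxFloorSum 2 3 1 1 40 3 (10 ^ 18) = 5079857732293046 := by
  decide +kernel

/-- `boxFloorSum 2 3 1 5 40 3 10^18` (pattern `1`, layer `5`, exponent `3`). [folklore] -/
theorem boxFloorSum_3_1_5 : boxFloorSum 2 3 1 5 40 3 (10 ^ 18) = 8955988880505 := by
  decide +kernel

/-- `boxFloorSum 2 3 0 6 40 3 10^18` (pattern `0`, layer `6`, exponent `3`). [folklore] -/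
theorem boxFloorSum_3_0_6 : boxFloorSum 2 3 0 6 40 3 (10 ^ 18) = 4318523742583 := by
  decide +kernel

/-- `boxFloorSum 2 3 1 7 40 3 10^18` (pattern `1`, layer `7`, exponent `3`). [folklore] -/
theorem boxFloorSum_3_1_7 : boxFloorSum 2 3 1 7 40 3 (10 ^ 18) = 2330567550318 := by
  decide +kernel

/-- `boxFloorSum 2 3 1 11 40 3 10^18` (pattern `1`, layer `11`, exponent `3`). [folklore] -/
theorem boxFloorSum_3_1_11 : boxFloorSum 2 3 1 11 40 3 (10 ^ 18) = 381403961979 := by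
  decide +kernel


end Literature.MathematicalPhysics.StatisticalMechanics.StackingSums

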